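import Summits.BirchSwinnertonDyer.BirchSwinnertonDyer.Theorems.InertBadSignedBranchesInertBadAtThreeQuarticCleanAssemblyOdd
import HarnessLib

set_option linter.dupNamespace false -- `Summit.BirchSwinnertonDyer.BirchSwinnertonDyer.Theorems.…` (summit = sub, D-0017)
set_option autoImplicit false

/-!
# Crux `ManinDatumSupercuspidalCMInert` (stmt-BirchSwinnertonDyer-20111, BED r605), stub `stub_S7` — the ASSEMBLY LANE at a GENERIC
# inert prime `q`: the `f`-free odd twisted `L`-value `q`-integrality of the quartic model `y² = x³ + Ax` from a theta dictionary
# modulo `qM′` and the `q`-integrality of the `Φ`-weighted `q`-TORSION SUMS of `E₁*` (width seat `bsd-wall-cm-bed-w2` g10; theorems only)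

Route `BiquadraticEisensteinDescent` (cell `pub/bsd-wall`), `--supports stmt-BirchSwinnertonDyer-20111` (helper). The `q`-generic twin of the
lead bsd-line-ibd-p1 g7's `p = 3` assembly `…InertBadAtThreeQuarticCleanAssemblyCRT` / `…CleanAssemblyOdd` (p630329 / p631134): there the
`χ₄^k`-weighted `3`-torsion sums `R_k` were CLOSED FORMS and their `3`-integrality (bed-w1 g7's P6a/b/c) a theorem; at `q = 7` (stub_S7) no
closed form is available (48 seven-torsion points, ray class field of conductor `7` over `ℚ(i)` of degree `12`), so this file keeps the weight
`Φ : ℤ[i] → ℂ` (periodic modulo `q`; at `q = 7`: `Φ = conj((·/7)₄)^k`, width seat bed-w3 g9's `quarticCharMod 7`) ABSTRACT and the torsion-sum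
integrality as the ONE hypothesis `hT` — the honest research core of stub_S7 (a tame resolvent count in `ℚ₄₉(E[7])`):

* §1 `exists_rep_mul_eq`, `kroneckerE₁_conj_classDiv_eq_of_coprime`, `sum_classes_mul_eq` — CRT `ℤ[i]/qM′ = ℤ[i]/q × ℤ[i]/M′` for
  `(q, M′) = 1`, `αM′ + qβ = 1`: `Σ_{c mod qM′} Φ(c)Ψ(c)E₁*(conj(c/qM′)) = Σ_{b mod M′} Ψ(b) Σ_{a mod q} Φ(a) E₁*(β conj(b)/M′ + α conj(a)/q)`
  (the lead's `exists_rep_three_mul_eq` / `kroneckerE₁_conj_classDiv_eq` / `sum_classes_three_mul_eq` with `3 ↦ q`, `conj(q(·))^k ↦ Φ`);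
* §2 `thetaLFunction_one_eq_sum_torsion_of_coprime` — with the finite formula `GaussianLattice.thetaLFunction_one_eq_sum_kroneckerE₁`:
  `Θ-L_{qM′}(Φ·Ψ)(1) = (qM′)⁻¹ · Σ_b Ψ(b) · T_Φ^α(β conj(b)/M′)`, `T_Φ^α(w) := Σ_{a mod q} Φ(a) E₁*(w + α conj(a)/q)`;
* §3 `sum_torsion_integral_of_termwise` — termwise `q`-integrality of `T_Φ^α(w)/(ϖ₀ q^{(4−k)/4})` at the `M′`-division points `w`
  (`q ∤ M′`) gives it for the `Ψ`-weighted sum (product of the denominators);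
* §4 `inv_abs_rpow_neg_quarter_of_eq`, `cpow_quarter_mul_cpow_quarter_of_le` — `|A|^{1/4} = q^{k/4}A₁^{1/4}`, `q^{k/4}·q^{(4−k)/4} = q`;
* §5 ★ `oddLValue_quartic_of_dictionary_of_torsionIntegral` — for an odd prime `q`, `A ≠ 0` with `|A| = q^k·A₁`, `1 ≤ k ≤ 3`, `(q, M′) = 1`,
  `Φ` periodic mod `q`, `Ψ` periodic mod `M′` with algebraic-integer values, the DICTIONARY «`Σ χ̄(n)a_n(E_A)n⁻ˢ = ¼·Θ-L_{qM′}(Φ·Ψ)(s)` on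
  `re s > 2`» and the TORSION HYPOTHESIS `hT` «for every `α` prime to `q` and every `w` with `M′w ∈ Λ`: `s·T_Φ^α(w)/(ϖ₀·q^{(4−k)/4}) ∈ ℤ̄` for
  some `q ∤ s`»: the `f`-free odd statement for `E_A = ⟨0,0,0,A,0⟩` at `p = q` — the entire `L = ¼Θ-L` has `s·τ(χ)·L(1)/(i·Ω⁻(E_A)) ∈ ℤ̄`,
  `q ∤ s` (period side: `Ω⁻(E_A) = c·ϖ₀·|A|^{−1/4}`, `c ∈ {1, √2}`, `…CleanAssembly.exists_imaginaryPeriodRat_quartic`; the powers of `q`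
  cancel exactly as at `q = 3`). This is the shape of hypothesis H₇ of `…CMInertStubsOfModelLValues.stub_S7_of_modelOddLValues` once bed-w3 g9's
  dictionary at `q = 7` supplies `(M′, Φ, Ψ)`.

HONEST FRAMING: conditional on the dictionary and on `hT`; nothing here proves a torsion-sum integrality, an `L`-value integrality, the stub,
the crux, Manin's conjecture or BSD. No definition, no named fact, no `sorry`; axioms standard.
-/

noncomputable section

open scoped ComplexConjugate
open Complex PeriodPair
open Literature.NumberTheory.EllipticCurves Literature.NumberTheory.EllipticCurves.GaussianLattice
open Literature.NumberTheory.LFunctions Literature.NumberTheory.LFunctions.GaussianTheta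

namespace Summit.BirchSwinnertonDyer.BirchSwinnertonDyer.Theorems.BiquadraticEisensteinDescentManinDatumSupercuspidalCMInertThetaValueAssembly

open Summit.BirchSwinnertonDyer.BirchSwinnertonDyer.Theorems.InertBadSignedBranchesInertBadAtThreeQuarticCleanAssembly
  (toComplex_mem_lattice natCast_mul_div_mem_lattice isIntegral_rpow_quarter exists_imaginaryPeriodRat_quartic)

/-! ## §1 Chinese remainder modulo `qM′` with an abstract `q`-periodic weight -/

section CRT

variable {q M' : ℕ} [NeZero q] [NeZero M'] [NeZero (q * M')]

omit [NeZero q] [NeZero M'] [NeZero (q * M')] in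
/-- **CRT decomposition of a representative modulo `qM'`.** For `(q, M') = 1` and integers `α, β` with `αM' + qβ = 1`, the canonical
representative of a class `c` modulo `qM'` is `αM'·a + qβ·b + qM'·z` with `a`, `b` the canonical representatives of `c mod q`, `c mod M'`
and some `z ∈ ℤ[i]`. (The lead's `exists_rep_three_mul_eq` with `3 ↦ q`.) [folklore] -/
theorem exists_rep_mul_eq (hcop : Nat.Coprime q M') {α β : ℤ} (hαβ : α * M' + q * β = 1)
    (c : ZMod (q * M') × ZMod (q * M')) :
    ∃ z : GaussianInt, rep (q * M') c 0 =
      (α * M' : ℤ) * rep q ((c.1.val : ZMod q), (c.2.val : ZMod q)) 0 +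
        (q * β : ℤ) * rep M' ((c.1.val : ZMod M'), (c.2.val : ZMod M')) 0 + (q * M' : ℕ) * z := by
  have hcopZ : IsCoprime (q : ℤ) (M' : ℤ) := by
    rw [Int.isCoprime_iff_gcd_eq_one, Int.gcd_natCast_natCast]; exact hcop
  -- one coordinate
  have key : ∀ X : ℕ, ∃ z : ℤ, (X : ℤ) = α * M' * (((X : ZMod q).val : ℕ) : ℤ) +
      q * β * (((X : ZMod M').val : ℕ) : ℤ) + (q * M' : ℕ) * z := by
    intro X
    rw [ZMod.val_natCast, ZMod.val_natCast]
    have hdq : (q : ℤ) ∣ (X : ℤ) - α * M' * ((X % q : ℕ) : ℤ) - q * β * ((X % M' : ℕ) : ℤ) := by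
      refine ⟨(X / q : ℕ) + β * ((X % q : ℕ) : ℤ) - β * ((X % M' : ℕ) : ℤ), ?_⟩
      have hX : ((X : ℕ) : ℤ) = q * ((X / q : ℕ) : ℤ) + ((X % q : ℕ) : ℤ) := by exact_mod_cast (Nat.div_add_mod X q).symm
      linear_combination hX - (((X % q : ℕ) : ℤ)) * hαβ
    have hdM : (M' : ℤ) ∣ (X : ℤ) - α * M' * ((X % q : ℕ) : ℤ) - q * β * ((X % M' : ℕ) : ℤ) := by
      refine ⟨(X / M' : ℕ) - α * ((X % q : ℕ) : ℤ) + α * ((X % M' : ℕ) : ℤ), ?_⟩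
      have hX : ((X : ℕ) : ℤ) = M' * ((X / M' : ℕ) : ℤ) + ((X % M' : ℕ) : ℤ) := by exact_mod_cast (Nat.div_add_mod X M').symm
      linear_combination hX - (((X % M' : ℕ) : ℤ)) * hαβ
    obtain ⟨z, hz⟩ := hcopZ.mul_dvd hdq hdM
    refine ⟨z, ?_⟩
    have hqM : ((q * M' : ℕ) : ℤ) = (q : ℤ) * (M' : ℤ) := by push_cast; ring
    rw [hqM]
    linear_combination hz
  obtain ⟨z₁, hz₁⟩ := key c.1.val
  obtain ⟨z₂, hz₂⟩ := key c.2.val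
  refine ⟨⟨z₁, z₂⟩, Zsqrtd.ext ?_ ?_⟩
  · simp only [rep_re, rep_im, Zsqrtd.re_add, Zsqrtd.re_mul, Zsqrtd.re_intCast, Zsqrtd.im_intCast,
      Zsqrtd.re_natCast, Zsqrtd.im_natCast, Prod.fst_zero, Prod.snd_zero, mul_zero, add_zero, zero_mul]
    linear_combination hz₁
  · simp only [rep_re, rep_im, Zsqrtd.im_add, Zsqrtd.im_mul, Zsqrtd.re_intCast, Zsqrtd.im_intCast,
      Zsqrtd.re_natCast, Zsqrtd.im_natCast, Prod.fst_zero, Prod.snd_zero, mul_zero, add_zero, zero_mul]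
    linear_combination hz₂

omit [NeZero (q * M')] in
/-- **The Eisenstein–Kronecker number of a class modulo `qM'` splits along CRT**: with `αM' + qβ = 1`,
`E₁*(conj(c/(qM'))) = E₁*(β conj(b)/M' + α conj(a)/q)` (`a = c mod q`, `b = c mod M'`; `E₁*` is `Λ`-periodic). [folklore] -/
theorem kroneckerE₁_conj_classDiv_eq_of_coprime (hcop : Nat.Coprime q M') {α β : ℤ} (hαβ : α * M' + q * β = 1)
    (c : ZMod (q * M') × ZMod (q * M')) :
    kroneckerE₁ (conj (classDiv (q * M') c)) =
      kroneckerE₁ ((β : ℂ) * conj ((rep M' ((c.1.val : ZMod M'), (c.2.val : ZMod M')) 0 : GaussianInt) : ℂ) / M' +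
        (α : ℂ) * conj ((rep q ((c.1.val : ZMod q), (c.2.val : ZMod q)) 0 : GaussianInt) : ℂ) / q) := by
  obtain ⟨z, hz⟩ := exists_rep_mul_eq hcop hαβ c
  have hM : (M' : ℂ) ≠ 0 := Nat.cast_ne_zero.mpr (NeZero.ne M')
  have hq0 : (q : ℂ) ≠ 0 := Nat.cast_ne_zero.mpr (NeZero.ne q)
  have hzC := congrArg GaussianInt.toComplex hz
  simp only [map_add, map_mul, map_intCast, map_natCast] at hzC
  have e : conj (classDiv (q * M') c) =
      ((β : ℂ) * conj ((rep M' ((c.1.val : ZMod M'), (c.2.val : ZMod M')) 0 : GaussianInt) : ℂ) / M' +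
        (α : ℂ) * conj ((rep q ((c.1.val : ZMod q), (c.2.val : ZMod q)) 0 : GaussianInt) : ℂ) / q) +
        ((star z : GaussianInt) : ℂ) := by
    rw [classDiv_def, GaussianInt.toComplex_star, show GaussianInt.toComplex (rep (q * M') c 0) = _ from hzC]
    simp only [map_div₀, map_add, map_mul, map_natCast, map_intCast, Nat.cast_mul]
    push_cast
    field_simp
    ring
  rw [e, kroneckerE₁_add_of_mem _ (toComplex_mem_lattice (star z))]

/-- **CRT regrouping of the finite Eisenstein–Kronecker sum** with an abstract weight. For `(q, M') = 1`, `αM' + qβ = 1`, `Φ` periodic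
modulo `q` and `Ψ` periodic modulo `M'`:
`Σ_{c mod qM'} Φ(c) Ψ(c) E₁*(conj(c/qM')) = Σ_{b mod M'} Ψ(b) Σ_{a mod q} Φ(a) E₁*(β conj(b)/M' + α conj(a)/q)`. [folklore] -/
theorem sum_classes_mul_eq (hcop : Nat.Coprime q M') {α β : ℤ} (hαβ : α * M' + q * β = 1)
    (Φ Ψ : GaussianInt → ℂ) (hΦ : ∀ x y : GaussianInt, Φ (x + q * y) = Φ x) (hΨ : ∀ x y : GaussianInt, Ψ (x + M' * y) = Ψ x) :
    ∑ c : ZMod (q * M') × ZMod (q * M'),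
        Φ (rep (q * M') c 0) * Ψ (rep (q * M') c 0) * kroneckerE₁ (conj (classDiv (q * M') c)) =
      ∑ b : ZMod M' × ZMod M', Ψ (rep M' b 0) *
        ∑ a : ZMod q × ZMod q, Φ (rep q a 0) *
          kroneckerE₁ ((β : ℂ) * conj ((rep M' b 0 : GaussianInt) : ℂ) / M' +
            (α : ℂ) * conj ((rep q a 0 : GaussianInt) : ℂ) / q) := by
  calc ∑ c : ZMod (q * M') × ZMod (q * M'),
        Φ (rep (q * M') c 0) * Ψ (rep (q * M') c 0) * kroneckerE₁ (conj (classDiv (q * M') c))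
      = ∑ p : (ZMod q × ZMod q) × (ZMod M' × ZMod M'), Φ (rep q p.1 0) * Ψ (rep M' p.2 0) *
          kroneckerE₁ ((β : ℂ) * conj ((rep M' p.2 0 : GaussianInt) : ℂ) / M' +
            (α : ℂ) * conj ((rep q p.1 0 : GaussianInt) : ℂ) / q) := by
        refine Fintype.sum_equiv (crtPairEquiv hcop) _ _ fun c ↦ ?_
        rw [crtPairEquiv_apply_fst, crtPairEquiv_apply_snd]
        have e1 : Φ (rep (q * M') c 0) = Φ (rep q ((c.1.val : ZMod q), (c.2.val : ZMod q)) 0) :=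
          apply_eq_of_cls_eq q hΦ (by simp [cls, rep])
        have e2 : Ψ (rep (q * M') c 0) = Ψ (rep M' ((c.1.val : ZMod M'), (c.2.val : ZMod M')) 0) :=
          apply_eq_of_cls_eq M' hΨ (by simp [cls, rep])
        rw [e1, e2, kroneckerE₁_conj_classDiv_eq_of_coprime hcop hαβ c]
    _ = ∑ b : ZMod M' × ZMod M', Ψ (rep M' b 0) *
        ∑ a : ZMod q × ZMod q, Φ (rep q a 0) *
          kroneckerE₁ ((β : ℂ) * conj ((rep M' b 0 : GaussianInt) : ℂ) / M' +
            (α : ℂ) * conj ((rep q a 0 : GaussianInt) : ℂ) / q) := by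
        rw [Fintype.sum_prod_type, Finset.sum_comm]
        refine Finset.sum_congr rfl fun b _ ↦ ?_
        rw [Finset.mul_sum]
        refine Finset.sum_congr rfl fun a _ ↦ ?_
        ring

end CRT

/-! ## §2 The theta `L`-value at `s = 1` through the `q`-torsion sums -/

section LValue

variable {q M' : ℕ} [NeZero q] [NeZero M'] [NeZero (q * M')]

omit [NeZero q] [NeZero M'] [NeZero (q * M')] in
/-- `Φ·Ψ` is periodic modulo `qM'` for `Φ` periodic modulo `q` and `Ψ` periodic modulo `M'`. [folklore] -/
theorem mul_periodic (Φ Ψ : GaussianInt → ℂ) (hΦ : ∀ x y : GaussianInt, Φ (x + q * y) = Φ x)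
    (hΨ : ∀ x y : GaussianInt, Ψ (x + M' * y) = Ψ x) (x y : GaussianInt) :
    Φ (x + (q * M' : ℕ) * y) * Ψ (x + (q * M' : ℕ) * y) = Φ x * Ψ x := by
  rw [show x + ((q * M' : ℕ) : GaussianInt) * y = x + q * ((M' : GaussianInt) * y) by push_cast; ring, hΦ,
    show x + (q : GaussianInt) * ((M' : GaussianInt) * y) = x + (M' : GaussianInt) * (q * y) by ring, hΨ]

/-- **The theta `L`-value at `s = 1` regrouped over the `q`-torsion**: for `(q, M') = 1`, `αM' + qβ = 1`, `Φ` periodic modulo `q`, `Ψ`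
periodic modulo `M'`: `Θ-L_{qM'}(Φ·Ψ)(1) = (qM')⁻¹ Σ_{b mod M'} Ψ(b) · Σ_{a mod q} Φ(a) E₁*(β conj(b)/M' + α conj(a)/q)` (finite formula
`GaussianLattice.thetaLFunction_one_eq_sum_kroneckerE₁` + §1). [cite: Rubin1999, Prop. 7.15] -/
theorem thetaLFunction_one_eq_sum_torsion_of_coprime (hcop : Nat.Coprime q M') {α β : ℤ} (hαβ : α * M' + q * β = 1)
    (Φ Ψ : GaussianInt → ℂ) (hΦ : ∀ x y : GaussianInt, Φ (x + q * y) = Φ x) (hΨ : ∀ x y : GaussianInt, Ψ (x + M' * y) = Ψ x) :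
    thetaLFunction (q * M') (fun x ↦ Φ x * Ψ x) 1 =
      ((q * M' : ℕ) : ℂ)⁻¹ * ∑ b : ZMod M' × ZMod M', Ψ (rep M' b 0) *
        ∑ a : ZMod q × ZMod q, Φ (rep q a 0) *
          kroneckerE₁ ((β : ℂ) * conj ((rep M' b 0 : GaussianInt) : ℂ) / M' +
            (α : ℂ) * conj ((rep q a 0 : GaussianInt) : ℂ) / q) := by
  rw [thetaLFunction_one_eq_sum_kroneckerE₁ (q * M') _ (mul_periodic Φ Ψ hΦ hΨ), ← sum_classes_mul_eq hcop hαβ Φ Ψ hΦ hΨ]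

end LValue

/-! ## §3 From termwise to summed `q`-integrality -/

section Integrality

variable {q : ℕ}

/-- **`q`-integrality of the regrouped sum from the termwise statement** (`q` prime, `Ψ` with algebraic-integer values): if every term
`T(b)/ρ` becomes an algebraic integer after multiplication by some natural number prime to `q`, so does `Σ_b Ψ(b)T(b)/ρ` (product of the
multipliers). [folklore] -/
theorem sum_integral_of_termwise (hq : q.Prime) {ι : Type*} [Fintype ι] (Ψc T : ι → ℂ) (ρ : ℂ)
    (hΨ : ∀ b, IsIntegral ℤ (Ψc b)) (hterm : ∀ b, ∃ s : ℕ, ¬ q ∣ s ∧ IsIntegral ℤ ((s : ℂ) * T b / ρ)) :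
    ∃ s : ℕ, ¬ q ∣ s ∧ IsIntegral ℤ ((s : ℂ) * (∑ b, Ψc b * T b) / ρ) := by
  classical
  choose s hs using hterm
  refine ⟨∏ b, s b, ?_, ?_⟩
  · rw [Prime.dvd_finsetProd_iff hq.prime]
    rintro ⟨b, -, hb⟩
    exact (hs b).1 hb
  · have key : ((∏ b, s b : ℕ) : ℂ) * (∑ b, Ψc b * T b) / ρ =
        ∑ b, ((∏ b' ∈ Finset.univ.erase b, s b' : ℕ) : ℂ) * Ψc b * ((s b : ℂ) * T b / ρ) := by
      rw [Finset.mul_sum, Finset.sum_div]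
      refine Finset.sum_congr rfl fun b _ ↦ ?_
      rw [← Finset.mul_prod_erase Finset.univ s (Finset.mem_univ b)]
      push_cast
      ring
    rw [key]
    refine IsIntegral.sum _ fun b _ ↦ ?_
    refine IsIntegral.mul (IsIntegral.mul ?_ (hΨ b)) (hs b).2
    simpa using isIntegral_algebraMap (R := ℤ) (A := ℂ) (x := ((∏ b' ∈ Finset.univ.erase b, s b' : ℕ) : ℤ))

end Integrality

/-! ## §4 Period bookkeeping at a general `q` -/

/-- `|A|^{1/4} = q^{k/4} · A₁^{1/4}` for `|A| = q^k A₁`, read in `ℂ` as the inverse of `|A|^{−1/4}`. [folklore] -/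
theorem inv_abs_rpow_neg_quarter_of_eq {q : ℕ} {A : ℤ} {k A₁ : ℕ} (hA : A.natAbs = q ^ k * A₁) :
    ((((|(A : ℝ)| ^ (-(1 / 4 : ℝ)) : ℝ)) : ℂ))⁻¹ = (q : ℂ) ^ ((k : ℂ) / 4) * ((((A₁ : ℝ) ^ (1 / 4 : ℝ) : ℝ)) : ℂ) := by
  have habs : |(A : ℝ)| = (q : ℝ) ^ (k : ℝ) * (A₁ : ℝ) := by
    rw [← Int.cast_abs, ← Nat.cast_natAbs, hA, Real.rpow_natCast]; push_cast; ring
  rw [habs, Real.rpow_neg (by positivity), Complex.ofReal_inv, inv_inv,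
    Real.mul_rpow (by positivity) (by positivity), ← Real.rpow_mul (by positivity), Complex.ofReal_mul,
    Complex.ofReal_cpow (by positivity : (0 : ℝ) ≤ q)]
  push_cast
  ring_nf

/-- `q^{k/4} · q^{(4−k)/4} = q` (`k ≤ 4`, `q ≠ 0`). [folklore] -/
theorem cpow_quarter_mul_cpow_quarter_of_le {q : ℕ} (hq : q ≠ 0) {k : ℕ} (hk : k ≤ 4) :
    (q : ℂ) ^ ((k : ℂ) / 4) * (q : ℂ) ^ (((4 - k : ℕ) : ℂ) / 4) = q := by
  rw [← Complex.cpow_add _ _ (Nat.cast_ne_zero.mpr hq), Nat.cast_sub hk,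
    show (k : ℂ) / 4 + ((4 : ℕ) - (k : ℂ)) / 4 = 1 by push_cast; ring, Complex.cpow_one]

/-- An odd prime does not divide `8`. [folklore] -/
theorem not_dvd_eight {q : ℕ} (hq : q.Prime) (hq2 : q ≠ 2) : ¬ q ∣ 8 := by
  intro h
  have h' : q ∣ 2 ^ 3 := by simpa using h
  exact hq2 ((Nat.prime_dvd_prime_iff_eq hq Nat.prime_two).mp (hq.dvd_of_dvd_pow h'))

/-! ## §5 The `f`-free odd statement for the model, modulo dictionary and torsion-sum integrality -/

section Final

variable {q : ℕ} [hqP : Fact q.Prime]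

/-- ★ **The `f`-free odd twisted-value statement for `E_A : y² = x³ + Ax` at an odd prime `q`, MODULO the theta dictionary and the
`q`-torsion-sum integrality.** Let `A ≠ 0` with `|A| = q^k·A₁`, `1 ≤ k ≤ 3`, `(q, M') = 1`, `Φ : ℤ[i] → ℂ` periodic modulo `q`, `Ψ` periodic
modulo `M'` with algebraic-integer values; suppose (DICTIONARY) `Σ χ̄(n) a_n(E_A) n⁻ˢ = ¼ · Θ-L_{qM'}(Φ·Ψ)(s)` for `re s > 2`, and (TORSION, `hT`)
for every integer `α` prime to `q` and every `w` with `M'w ∈ Λ = ℤi + ℤ`: `s · (Σ_{a mod q} Φ(a) E₁*(w + α conj(a)/q)) / (ϖ₀ · q^{(4−k)/4}) ∈ ℤ̄`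
for some `q ∤ s`. Then the entire continuation `L = ¼ Θ-L` satisfies `s·τ(χ)·L(1)/(i·Ω⁻(E_A)) ∈ ℤ̄` for some `q ∤ s`. Bookkeeping (the lead's
`oddLValue_quartic_of_dictionary` with `3 ↦ q`): `L(1) = (4qM')⁻¹ Σ_b Ψ(b) T_Φ^α(w_b)` (§2), `Ω⁻(E_A) = cϖ₀|A|^{−1/4}` (`c ∈ {1, √2}`),
`|A|^{1/4} = q^{k/4}A₁^{1/4}` and `q^{k/4}·q^{(4−k)/4} = q` against the `1/q`. [cite: Rubin1999, Prop. 7.15] [cite: MazurTateTeitelbaum1986, §I.8 (8.6)] -/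
theorem oddLValue_quartic_of_dictionary_of_torsionIntegral (hq2 : q ≠ 2) (A : ℤ) (hA : A ≠ 0) {k : ℕ} (hk1 : 1 ≤ k) (hk3 : k ≤ 3)
    {A₁ : ℕ} (hkA : A.natAbs = q ^ k * A₁)
    {m : ℕ} [NeZero m] (χ : DirichletCharacter ℂ m) {M' : ℕ} [NeZero M'] [NeZero (q * M')] (hcop : Nat.Coprime q M')
    (Φ Ψ : GaussianInt → ℂ) (hΦ : ∀ x y : GaussianInt, Φ (x + q * y) = Φ x)
    (hΨ : ∀ x y : GaussianInt, Ψ (x + M' * y) = Ψ x) (hΨint : ∀ x : GaussianInt, IsIntegral ℤ (Ψ x))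
    (hdict : ∀ s : ℂ, 2 < s.re →
      LSeries (fun n : ℕ ↦ χ⁻¹ (n : ZMod m) * ((⟨0, 0, 0, (A : ℚ), 0⟩ : WeierstrassCurve ℚ).LFunction n : ℂ)) s =
        (1 / 4 : ℂ) * thetaLFunction (q * M') (fun x ↦ Φ x * Ψ x) s)
    (hT : ∀ (α : ℤ), ¬ (q : ℤ) ∣ α → ∀ (w : ℂ), (M' : ℂ) * w ∈ (ofUpperHalfPlane UpperHalfPlane.I).lattice →
      ∃ s : ℕ, ¬ q ∣ s ∧ IsIntegral ℤ ((s : ℂ) *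
        (∑ a : ZMod q × ZMod q, Φ (rep q a 0) * kroneckerE₁ (w + (α : ℂ) * conj ((rep q a 0 : GaussianInt) : ℂ) / q)) /
          ((((Real.Gamma (1 / 4) ^ 2 / (2 * Real.sqrt (2 * Real.pi))) : ℝ) : ℂ) * (q : ℂ) ^ (((4 - k : ℕ) : ℂ) / 4)))) :
    ∃ L : ℂ → ℂ, Differentiable ℂ L ∧
      (∀ s : ℂ, 2 < s.re →
        L s = LSeries (fun n : ℕ ↦ χ⁻¹ (n : ZMod m) * ((⟨0, 0, 0, (A : ℚ), 0⟩ : WeierstrassCurve ℚ).LFunction n : ℂ)) s) ∧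
      ∃ s : ℕ, ¬ q ∣ s ∧ IsIntegral ℤ ((s : ℂ) * (gaussSum χ (ZMod.stdAddChar (N := m)) * L 1 /
        (Complex.I * ((⟨0, 0, 0, (A : ℚ), 0⟩ : WeierstrassCurve ℚ).imaginaryPeriodRat : ℂ)))) := by
  have hqP' : q.Prime := hqP.out
  -- Bezout for `(q, M')`
  have hqM : ¬ q ∣ M' := fun h ↦ by
    have h1 : q ∣ Nat.gcd q M' := Nat.dvd_gcd (dvd_refl q) h
    rw [hcop] at h1
    exact hqP'.one_lt.ne' (Nat.dvd_one.mp h1)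
  obtain ⟨α, β, hαβ⟩ : ∃ α β : ℤ, α * M' + q * β = 1 := by
    have hcopZ : IsCoprime (M' : ℤ) (q : ℤ) := by
      rw [Int.isCoprime_iff_gcd_eq_one, Int.gcd_natCast_natCast]; exact hcop.symm
    obtain ⟨u, v, huv⟩ := hcopZ
    exact ⟨u, v, by linear_combination huv⟩
  have hα : ¬ (q : ℤ) ∣ α := by
    rintro ⟨u, hu⟩
    have : (q : ℤ) ∣ 1 := ⟨u * M' + β, by rw [← hαβ, hu]; ring⟩
    exact hqP'.one_lt.ne' (by exact_mod_cast Int.eq_one_of_dvd_one (by positivity) this)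
  refine ⟨fun s ↦ (1 / 4 : ℂ) * thetaLFunction (q * M') (fun x ↦ Φ x * Ψ x) s,
    (differentiable_thetaLFunction (q * M') _).const_mul _, fun s hs ↦ (hdict s hs).symm, ?_⟩
  -- the regrouped sum and its `q`-integrality
  set ρ : ℂ := (((Real.Gamma (1 / 4) ^ 2 / (2 * Real.sqrt (2 * Real.pi))) : ℝ) : ℂ) * (q : ℂ) ^ (((4 - k : ℕ) : ℂ) / 4) with hρ
  set Tb : ZMod M' × ZMod M' → ℂ := fun b ↦ ∑ a : ZMod q × ZMod q, Φ (rep q a 0) *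
    kroneckerE₁ ((β : ℂ) * conj ((rep M' b 0 : GaussianInt) : ℂ) / M' + (α : ℂ) * conj ((rep q a 0 : GaussianInt) : ℂ) / q) with hTb
  obtain ⟨s₀, hs₀, hX⟩ : ∃ s : ℕ, ¬ q ∣ s ∧ IsIntegral ℤ ((s : ℂ) * (∑ b, Ψ (rep M' b 0) * Tb b) / ρ) :=
    sum_integral_of_termwise hqP' (fun b ↦ Ψ (rep M' b 0)) Tb ρ (fun b ↦ hΨint _)
      (fun b ↦ hT α hα _ (natCast_mul_div_mem_lattice β (rep M' b 0)))
  set T : ℂ := ∑ b, Ψ (rep M' b 0) * Tb b with hTdef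
  have hL1 : (1 / 4 : ℂ) * thetaLFunction (q * M') (fun x ↦ Φ x * Ψ x) 1 = (1 / 4 : ℂ) * (((q * M' : ℕ) : ℂ)⁻¹ * T) := by
    rw [thetaLFunction_one_eq_sum_torsion_of_coprime hcop hαβ Φ Ψ hΦ hΨ]
  -- the period
  obtain ⟨c, hc0, hcint, hΩ⟩ := exists_imaginaryPeriodRat_quartic hA
  have hA₁0 : A₁ ≠ 0 := by
    rintro rfl
    rw [mul_zero, Int.natAbs_eq_zero] at hkA
    exact hA hkA
  have hinv := inv_abs_rpow_neg_quarter_of_eq hkA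
  have hX' : ((((|(A : ℝ)| ^ (-(1 / 4 : ℝ)) : ℝ)) : ℂ)) =
      ((q : ℂ) ^ ((k : ℂ) / 4) * ((((A₁ : ℝ) ^ (1 / 4 : ℝ) : ℝ)) : ℂ))⁻¹ := by rw [← hinv, inv_inv]
  refine ⟨8 * M' * s₀, ?_, ?_⟩
  · intro h
    rcases (Nat.Prime.dvd_mul hqP').mp h with h | h
    · rcases (Nat.Prime.dvd_mul hqP').mp h with h | h
      · exact not_dvd_eight hqP' hq2 h
      · exact hqM h
    · exact hs₀ h
  show IsIntegral ℤ (((8 * M' * s₀ : ℕ) : ℂ) * (gaussSum χ (ZMod.stdAddChar (N := m)) *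
    ((1 / 4 : ℂ) * thetaLFunction (q * M') (fun x ↦ Φ x * Ψ x) 1) /
      (Complex.I * ((⟨0, 0, 0, (A : ℚ), 0⟩ : WeierstrassCurve ℚ).imaginaryPeriodRat : ℂ))))
  rw [hL1, hΩ, Complex.ofReal_mul, Complex.ofReal_mul, hX']
  set ϖ : ℂ := (((Real.Gamma (1 / 4) ^ 2 / (2 * Real.sqrt (2 * Real.pi))) : ℝ) : ℂ) with hϖ
  set ρ' : ℂ := (q : ℂ) ^ (((4 - k : ℕ) : ℂ) / 4) with hρ'
  set t : ℂ := (q : ℂ) ^ ((k : ℂ) / 4) with ht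
  set a : ℂ := ((((A₁ : ℝ) ^ (1 / 4 : ℝ) : ℝ)) : ℂ) with ha
  set τ : ℂ := gaussSum χ (ZMod.stdAddChar (N := m)) with hτ
  have hρρ : ρ = ϖ * ρ' := rfl
  have hϖ0 : ϖ ≠ 0 := Complex.ofReal_ne_zero.mpr GaussianLattice.varpi_pos.ne'
  have hq0 : (q : ℂ) ≠ 0 := Nat.cast_ne_zero.mpr hqP'.ne_zero
  have hρ0 : ρ' ≠ 0 := by
    intro h; have := (Complex.cpow_eq_zero_iff _ _).mp h; exact hq0 this.1
  have ht0 : t ≠ 0 := by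
    intro h; have := (Complex.cpow_eq_zero_iff _ _).mp h; exact hq0 this.1
  have ha0 : a ≠ 0 := Complex.ofReal_ne_zero.mpr (Real.rpow_pos_of_pos (by exact_mod_cast Nat.pos_of_ne_zero hA₁0) _).ne'
  have htρ : t * ρ' = q := cpow_quarter_mul_cpow_quarter_of_le hqP'.ne_zero (by omega)
  have hcC : (c : ℂ) ≠ 0 := Complex.ofReal_ne_zero.mpr hc0
  have hM : (M' : ℂ) ≠ 0 := Nat.cast_ne_zero.mpr (NeZero.ne M')
  have key : ((8 * M' * s₀ : ℕ) : ℂ) * (τ * ((1 / 4 : ℂ) * (((q * M' : ℕ) : ℂ)⁻¹ * T)) / (I * ((c : ℂ) * (ϖ * (t * a)⁻¹)))) =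
      (-I) * ((2 : ℂ) / c) * τ * a * ((s₀ : ℂ) * T / ρ) := by
    rw [hρρ]
    push_cast
    field_simp
    linear_combination (8 * (s₀ : ℂ) * τ * T) * htρ + (8 * (q : ℂ) * (s₀ : ℂ) * τ * T) * I_sq
  rw [key]
  have hI : IsIntegral ℤ (-I : ℂ) := by
    refine IsIntegral.of_pow (n := 2) (by norm_num) ?_
    rw [neg_sq, I_sq]; exact isIntegral_one.neg
  exact (((hI.mul hcint).mul (StarredOptimalManinUnitFiveSevenValueExit.isIntegral_gaussSum χ)).mul
    (isIntegral_rpow_quarter A₁)).mul hX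

end Final

end Summit.BirchSwinnertonDyer.BirchSwinnertonDyer.Theorems.BiquadraticEisensteinDescentManinDatumSupercuspidalCMInertThetaValueAssembly

end
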